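import Mathlib
import Summits.ValiantsHypothesis.ValiantsHypothesis.Theorems.NewtonTauWeak.Negative.Zonogon
import Summits.ValiantsHypothesis.ValiantsHypothesis.Theorems.NewtonUnitEquationsNewtonTauWeakLevelBound

/-!
# `NewtonTauWeak` (stmt-ValiantsHypothesis-5904), line `binomial-normal-form`: the level bound in the
# crux's own language — sums of products whose factors live in level windows

Support file for the crux
`Summit.ValiantsHypothesis.ValiantsHypothesis.Theses.NewtonUnitEquations.NewtonTauWeak`
(KPTT arXiv:1308.2286, Conjecture 1 in the weak form of their Theorem 1), registered stub `stub_levelsSps`.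

Claim.  Fix a nonzero integer functional `ℓ(e) = a e₀ + b e₁`.  If every factor `f i j` of the crux's sum of
products `Σ_{i<k} Π_{j<m} f i j` has all its exponents at levels in the window `[lo j, hi j]` (the same window
for every product `i`), then

  `vert(Σ_i Π_j f i j) ≤ 2 · ((Σ_j (hi j - lo j)).toNat + 1)`.

Proof.  An exponent of a sum is an exponent of a summand (`MvPolynomial.support_sum`), and an exponent of a
product `Π_j f i j` is a sum `Σ_j e_j` of exponents `e_j ∈ supp (f i j)` (`MvPolynomial.support_mul`,
induction over the index set), so its level `Σ_j ℓ(e_j)` lies in `[Σ_j lo j, Σ_j hi j]`.  Hence `ℓ` takes at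
most `#Icc (Σ lo) (Σ hi) = (Σ hi + 1 - Σ lo).toNat ≤ (Σ_j (hi j - lo j)).toNat + 1` values on the support, and
the level bound `vert_le_two_mul_card_levels` (a convex polygon has at most two vertices per level line)
finishes.  In particular the crux holds, uniformly in `k`, on every family of factors of polynomially bounded
lattice width in some direction. [folklore]

Main result: `stub_levelsSps`.  Helpers in `LevelsSpsAux`.  No definitions, no named facts.
-/

-- the namespace mandated for this Theorems file repeats the component `ValiantsHypothesis`
set_option linter.dupNamespace false

noncomputable section

open scoped BigOperators Pointwise
open MvPolynomial
open Summit.ValiantsHypothesis.ValiantsHypothesis.Theorems.NewtonTauWeak.Negative (vert)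

namespace Summit.ValiantsHypothesis.ValiantsHypothesis.Theorems.NewtonUnitEquationsNewtonTauWeak

namespace LevelsSpsAux

/-- The level functional `ℓ(e) = a e₀ + b e₁` is additive on exponent vectors. [folklore] -/
theorem level_add (a b : ℤ) (e₁ e₂ : Fin 2 →₀ ℕ) :
    a * ((e₁ + e₂) 0 : ℤ) + b * ((e₁ + e₂) 1 : ℤ)
      = (a * (e₁ 0 : ℤ) + b * (e₁ 1 : ℤ)) + (a * (e₂ 0 : ℤ) + b * (e₂ 1 : ℤ)) := by
  simp only [Finsupp.coe_add, Pi.add_apply, Nat.cast_add]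
  ring

/-- **Levels of a product lie in the sum of the factors' level windows**: if every exponent of `g j`
(`j ∈ s`) has level in `[lo j, hi j]`, then every exponent of `Π_{j∈s} g j` has level in
`[Σ_{j∈s} lo j, Σ_{j∈s} hi j]` (an exponent of a product is a sum of exponents of the factors,
`MvPolynomial.support_mul`). [folklore] -/
theorem level_mem_window_prod {ι : Type*} (s : Finset ι) (g : ι → MvPolynomial (Fin 2) ℂ) (a b : ℤ)
    (lo hi : ι → ℤ)
    (hwin : ∀ j ∈ s, ∀ e ∈ (g j).support,
      lo j ≤ a * (e 0 : ℤ) + b * (e 1 : ℤ) ∧ a * (e 0 : ℤ) + b * (e 1 : ℤ) ≤ hi j) :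
    ∀ e ∈ (∏ j ∈ s, g j).support,
      ∑ j ∈ s, lo j ≤ a * (e 0 : ℤ) + b * (e 1 : ℤ) ∧ a * (e 0 : ℤ) + b * (e 1 : ℤ) ≤ ∑ j ∈ s, hi j := by
  classical
  induction s using Finset.induction_on with
  | empty =>
    intro e he
    rw [Finset.prod_empty, MvPolynomial.support_one, Finset.mem_singleton] at he
    subst he
    simp
  | insert j s hj ih =>
    intro e he
    rw [Finset.prod_insert hj] at he
    obtain ⟨e₁, he₁, e₂, he₂, rfl⟩ := Finset.mem_add.mp (MvPolynomial.support_mul _ _ he)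
    have h₁ := hwin j (Finset.mem_insert_self j s) e₁ he₁
    have h₂ := ih (fun j' hj' => hwin j' (Finset.mem_insert_of_mem hj')) e₂ he₂
    rw [Finset.sum_insert hj, Finset.sum_insert hj, level_add]
    exact ⟨add_le_add h₁.1 h₂.1, add_le_add h₁.2 h₂.2⟩

/-- **Levels of the crux's sum of products lie in the total window**: under the window hypothesis of
`stub_levelsSps`, the set of levels of `supp (Σ_i Π_j f i j)` is contained in `Icc (Σ_j lo j) (Σ_j hi j)`.
[folklore] -/
theorem levels_sps_subset_Icc (k m : ℕ) (f : Fin k → Fin m → MvPolynomial (Fin 2) ℂ) (a b : ℤ)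
    (lo hi : Fin m → ℤ)
    (hwin : ∀ i j, ∀ e ∈ (f i j).support,
      lo j ≤ a * (e 0 : ℤ) + b * (e 1 : ℤ) ∧ a * (e 0 : ℤ) + b * (e 1 : ℤ) ≤ hi j) :
    ((∑ i, ∏ j, f i j).support.image fun e : Fin 2 →₀ ℕ => a * (e 0 : ℤ) + b * (e 1 : ℤ))
      ⊆ Finset.Icc (∑ j, lo j) (∑ j, hi j) := by
  classical
  intro v hv
  obtain ⟨e, he, rfl⟩ := Finset.mem_image.mp hv
  obtain ⟨i, -, hi'⟩ := Finset.mem_biUnion.mp (MvPolynomial.support_sum he)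
  exact Finset.mem_Icc.mpr
    (level_mem_window_prod Finset.univ (f i) a b lo hi (fun j _ => hwin i j) e hi')

/-- The length of the total window: `#Icc (Σ lo) (Σ hi) ≤ (Σ_j (hi j - lo j)).toNat + 1`
(unconditionally, also for empty windows). [folklore] -/
theorem card_Icc_sum_le (m : ℕ) (lo hi : Fin m → ℤ) :
    (Finset.Icc (∑ j, lo j) (∑ j, hi j)).card ≤ (∑ j, (hi j - lo j)).toNat + 1 := by
  rw [Int.card_Icc, Finset.sum_sub_distrib]
  omega

end LevelsSpsAux

open LevelsSpsAux

/-- **The level bound in the crux's language** (registered stub `stub_levelsSps`, line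
`binomial-normal-form`): for every nonzero integer functional `ℓ(e) = a e₀ + b e₁`, if every factor
`f i j` of the sum of products `Σ_{i<k} Π_{j<m} f i j` has all its exponents at levels in `[lo j, hi j]`,
then `vert(Σ_i Π_j f i j) ≤ 2 ((Σ_j (hi j - lo j)).toNat + 1)` — the crux's conclusion holds with exponent
`1`, uniformly in `k`, on every family of factors of polynomially bounded lattice width. [folklore] -/
theorem stub_levelsSps (k m : ℕ) (f : Fin k → Fin m → MvPolynomial (Fin 2) ℂ) (a b : ℤ) (hab : a ≠ 0 ∨ b ≠ 0)
    (lo hi : Fin m → ℤ)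
    (hwin : ∀ i j, ∀ e ∈ (f i j).support, lo j ≤ a * (e 0 : ℤ) + b * (e 1 : ℤ) ∧ a * (e 0 : ℤ) + b * (e 1 : ℤ) ≤ hi j) :
    vert (∑ i, ∏ j, f i j) ≤ 2 * ((∑ j, (hi j - lo j)).toNat + 1) :=
  (vert_le_two_mul_card_levels _ hab).trans
    (Nat.mul_le_mul_left 2
      ((Finset.card_le_card (levels_sps_subset_Icc k m f a b lo hi hwin)).trans
        (card_Icc_sum_le m lo hi)))

end Summit.ValiantsHypothesis.ValiantsHypothesis.Theorems.NewtonUnitEquationsNewtonTauWeak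

end
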